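import Summits.RiemannHypothesis.RiemannHypothesis.Theorems.WeilParityEvenWinsBeyondArchParityCell91
import Summits.RiemannHypothesis.RiemannHypothesis.Theorems.GroundBartaEvenWinsBeyondArchUpper91Sharp
import Summits.RiemannHypothesis.RiemannHypothesis.Theorems.WeilFormatCDataO94OddRung
import Summits.RiemannHypothesis.RiemannHypothesis.Theorems.GroundBartaEvenWinsBeyondArchUpper94Sharp
import Summits.RiemannHypothesis.RiemannHypothesis.Theorems.WeilFormatCDataO97OddRung
import Summits.RiemannHypothesis.RiemannHypothesis.Theorems.GroundBartaEvenWinsBeyondArchUpper9729Sharp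
import Summits.RiemannHypothesis.RiemannHypothesis.Theorems.WeilFormatCDataO100OddRung
import Summits.RiemannHypothesis.RiemannHypothesis.Theorems.GroundBartaEvenWinsBeyondArchUpper100Sharp
import Summits.RiemannHypothesis.RiemannHypothesis.Theorems.WeilFormatCDataO102BOddRung
import Summits.RiemannHypothesis.RiemannHypothesis.Theorems.GroundBartaEvenWinsBeyondArchUpper102Sharp
import Summits.RiemannHypothesis.RiemannHypothesis.Theorems.WeilFormatCDataO103MOddRung
import Summits.RiemannHypothesis.RiemannHypothesis.Theorems.WeilGroundStateGroundStateSimpleEvenCellTransfer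
import Literature.NumberTheory.LFunctions.WeilGroundEnergyParitySplit
import HarnessLib

/-!
# RiemannHypothesis / GroundBarta — the parity ladder: PARITY CELL 14 `(51/50, 103/100]` CLOSED

Helper file (`--supports stmt-RiemannHypothesis-18085`, `NoParityCrossing`), RH-free.  Prover A (unit `sr-gb-rung-a`), after
`…ParityCell102` (cell 13, the ladder up to `51/50`).

The ladder step on `[51/50, 103/100]` (`ε`, `ε_od` antitone; `GroundStateSimpleEven.weilWindowSimpleEven_on_cell_of_le`) from three tree facts:
* the ladder up to `91/100` (cells 1–9): `weilWindowSimpleEven_upTo_91` (`…ParityCell91`), and the cell-10/11/12/13 steps re-derived inline from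
  `trialUpper91sharp` + `WeilFormatCData.O94.weilOddGroundEnergy_94_ge_inv_two_pow_75`, `trialUpper94sharp` +
  `WeilFormatCData.O97.weilOddGroundEnergy_9729_ge_inv_two_pow_81`, `trialUpper9729sharp` + `WeilFormatCData.O100.weilOddGroundEnergy_one_ge_inv_two_pow_88`
  and `trialUpper100sharp` + `WeilFormatCData.O102B.weilOddGroundEnergy_102_ge_inv_two_pow_93` (= `weilWindowSimpleEven_upTo_94/_9729/_one/_102` of
  `…ParityCell94/97/100/102`, whose hub oleans were pending — not imported);
* the U-side at `51/50`: `trialUpper102sharp : ε(51/50) ≤ 18·10⁻³¹` (`…Upper102Sharp`: even degree-102 Ritz vector `ne102v1`, n = 52, kit j254697,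
  Ritz value 1.82·10⁻³¹; the SHARPENED A-layer certificate `ne102v1_T` (kernel-endpoint literals, exact panel budgets, width 7.9·10⁻³⁵) and the
  five-prime killing-constant bracket `dt_f7_weilMarkovConstant_sharp5`);
* the L-side at `103/100`: `WeilFormatCData.O103M.weilOddGroundEnergy_103_ge_inv_two_pow_95 : 2⁻95 ≤ ε_od(103/100)`
  (`WeilFormatCDataO103MOddRung`, prover B's format-C ODD λ-run at `a = 103/100`, `μ = 2⁻95 > 18·10⁻³¹`).

* `weilWindowSimpleEven_upTo_103` — for every `0 < a ≤ 103/100` the ground state of the windowed Weil form is simple and even;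
* `weilEvenGroundEnergy_lt_weilOddGroundEnergy_upTo_103`, `tailSimpleEven_upTo_103`, `noParityCrossing_upTo_103`, `weilWindowSimpleEven_on_cell14` —
  the strict parity order / the item-18085 tail shape / the crux `NoParityCrossing` on the certified range `(0, 103/100]`.

Standard axioms; nothing is defined; no RH claim (a finite-range parity certificate).
-/

set_option linter.dupNamespace false

noncomputable section

open Set MeasureTheory

namespace Summit.RiemannHypothesis.RiemannHypothesis.Theorems.EvenWinsBeyondArch

open Literature.NumberTheory.LFunctions

/-- **Parity cell 14 closed: the ladder reaches `103/100`.**  For every window `0 < a ≤ 103/100` the windowed Weil form has a simple,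
even ground state. [folklore] -/
theorem weilWindowSimpleEven_upTo_103 : ∀ a : ℝ, 0 < a → a ≤ 103 / 100 → WeilWindowSimpleEven a := by
  intro a ha hac
  rcases le_or_gt a (51 / 50) with hab | hba
  · -- cells 1–13 (`weilWindowSimpleEven_upTo_102` of `…ParityCell102`, re-derived from built modules only)
    rcases le_or_gt a 1 with hab13 | hba13
    · rcases le_or_gt a (9729 / 10000) with hab12 | hba12
      · rcases le_or_gt a (47 / 50) with hab10 | hba10
        · rcases le_or_gt a (91 / 100) with hab9 | hba9
          · exact weilWindowSimpleEven_upTo_91 a ha hab9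
          · have hU9 := trialUpper91sharp
            have hL10 := WeilFormatCData.O94.weilOddGroundEnergy_94_ge_inv_two_pow_75
            have hUL9 : (2589 / 100000000000000000000000000 : ℝ) < (1 / 2 ^ 75 : ℝ) := by norm_num
            exact GroundStateSimpleEven.weilWindowSimpleEven_on_cell_of_le (b := 91 / 100) (c := 47 / 50) (by norm_num) hUL9 hU9
              (fun _ hg hs hn ho ↦ hL10.trans (weilOddGroundEnergy_le hg hs ho hn)) hba9.le hab10
        · have hU10 := trialUpper94sharp
          have hL11 := WeilFormatCData.O97.weilOddGroundEnergy_9729_ge_inv_two_pow_81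
          have hUL10 : (2322 / 10000000000000000000000000000 : ℝ) < (1 / 2 ^ 81 : ℝ) := by norm_num
          exact GroundStateSimpleEven.weilWindowSimpleEven_on_cell_of_le (b := 47 / 50) (c := 9729 / 10000) (by norm_num) hUL10 hU10
            (fun _ hg hs hn ho ↦ hL11.trans (weilOddGroundEnergy_le hg hs ho hn)) hba10.le hab12
      · have hU12 := trialUpper9729sharp
        have hL12 := WeilFormatCData.O100.weilOddGroundEnergy_one_ge_inv_two_pow_88
        have hUL12 : (9899 / 10000000000000000000000000000000 : ℝ) < (1 / 2 ^ 88 : ℝ) := by norm_num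
        exact GroundStateSimpleEven.weilWindowSimpleEven_on_cell_of_le (b := 9729 / 10000) (c := 1) (by norm_num) hUL12 hU12
          (fun _ hg hs hn ho ↦ hL12.trans (weilOddGroundEnergy_le hg hs ho hn)) hba12.le hab13
    · have hU13 := trialUpper100sharp
      have hL13 := WeilFormatCData.O102B.weilOddGroundEnergy_102_ge_inv_two_pow_93
      have hUL13 : (5566 / 100000000000000000000000000000000 : ℝ) < (1 / 2 ^ 93 : ℝ) := by norm_num
      exact GroundStateSimpleEven.weilWindowSimpleEven_on_cell_of_le (b := 1) (c := (51 : ℝ) / 50) (by norm_num) hUL13 hU13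
        (fun _ hg hs hn ho ↦ hL13.trans (weilOddGroundEnergy_le hg hs ho hn)) hba13.le hab
  · -- cell 14: U(51/50) = 18e-31 < 2^-95 ≤ ε_od(103/100)
    have hU := trialUpper102sharp
    have hL := WeilFormatCData.O103M.weilOddGroundEnergy_103_ge_inv_two_pow_95
    have hUL : (18 / 10000000000000000000000000000000 : ℝ) < (1 / 2 ^ 95 : ℝ) := by norm_num
    exact GroundStateSimpleEven.weilWindowSimpleEven_on_cell_of_le (b := (51 : ℝ) / 50) (c := (103 : ℝ) / 100) (by norm_num) hUL hU
      (fun _ hg hs hn ho ↦ hL.trans (weilOddGroundEnergy_le hg hs ho hn)) hba.le hac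

/-- The strict parity order `ε_ev(a) < ε_od(a)` for every `0 < a ≤ 103/100`. [folklore] -/
theorem weilEvenGroundEnergy_lt_weilOddGroundEnergy_upTo_103 {a : ℝ} (ha : 0 < a) (hle : a ≤ 103 / 100) :
    weilEvenGroundEnergy a < weilOddGroundEnergy a :=
  (weilWindowSimpleEven_iff_weilEvenGroundEnergy_lt ha).1 (weilWindowSimpleEven_upTo_103 a ha hle)

/-- Tail shape of item 18085 up to `103/100`: simple even ground states on every window `log 2 < a ≤ 103/100`. [folklore] -/
theorem tailSimpleEven_upTo_103 : ∀ a : ℝ, Real.log 2 < a → a ≤ 103 / 100 → WeilWindowSimpleEven a :=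
  fun a ha hle ↦ weilWindowSimpleEven_upTo_103 a ((Real.log_pos (by norm_num)).trans ha) hle

/-- **Item 18085's statement restricted to the certified range**: for every window `(log 3)/2 < a ≤ 103/100` the even and odd
sector bottoms do not coincide, `ε_ev(a) ≠ ε_od(a)` — the crux `NoParityCrossing` verified on the finite range of the parity
ladder (cells 1–14). [folklore] -/
theorem noParityCrossing_upTo_103 : ∀ a : ℝ, Real.log 3 / 2 < a → a ≤ 103 / 100 →
    weilEvenGroundEnergy a ≠ weilOddGroundEnergy a :=
  fun a ha hle ↦ (weilEvenGroundEnergy_lt_weilOddGroundEnergy_upTo_103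
    ((div_pos (Real.log_pos (by norm_num)) two_pos).trans ha) hle).ne

/-- Simple even ground states on every window of cell 14, `51/50 ≤ a ≤ 103/100`. [folklore] -/
theorem weilWindowSimpleEven_on_cell14 {a : ℝ} (h1 : (51 : ℝ) / 50 ≤ a) (hle : a ≤ 103 / 100) : WeilWindowSimpleEven a :=
  weilWindowSimpleEven_upTo_103 a (lt_of_lt_of_le (by norm_num) h1) hle

end Summit.RiemannHypothesis.RiemannHypothesis.Theorems.EvenWinsBeyondArch

end
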